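import Summits.RiemannHypothesis.RiemannHypothesis.Theorems.GroundBartaPolarPerronFrobeniusThetaWindowPhiTail
import Summits.RiemannHypothesis.RiemannHypothesis.Theorems.GroundBartaPolarPerronFrobeniusThetaWindowTest
import Mathlib.Analysis.SpecialFunctions.SmoothTransition
import Literature.Analysis.FluidPDE.SlicedLocalEnergy
import HarnessLib

/-!
# The collar tail of the smooth theta vector: pointwise bounds (route `RiemannHypothesis/GroundBarta`,
rung 3 `PolarPerronFrobenius`, stmt-RiemannHypothesis-18390 — theta-vector toolkit)

For the window `[-a, a]`, `a ≥ 2`, put `x = e^{2a}` and `b = a − e^{−2a}` (`1 ≤ b ≤ a`,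
`e^{2b} ≥ x − 2`).  The (real) collar tail `κ_a(s) = Φ(s)(1 − χ_a(s))` of the smooth theta window
vector vanishes on the bulk `|s| ≤ b`, satisfies `0 ≤ κ_a ≤ Φ`, and — because `Φ` and `Φ′` decay
like `e^{−πe^{2|s|}}` and the plateau cut-off varies on the scale `1/x` — obeys the COLLAR BOUNDS

  `κ_a(s) ≤ K₀ x^{9/4} e^{−πx}`,   `|κ_a′(s)| ≤ K₁ x^{13/4} e^{−πx}`   (all `s`),

and `ϖ_b = ∫_{s>b} Φ(s)·2cosh(s/2) ds ≤ K₂ x^{5/2} e^{−πx}` (`rateDecay_polarWeight_le`).  These feed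
the estimates of the translates `W(τ_u κ_a)` (next file).  RH-free, elementary.
References: de Bruijn / Rodgers–Tao 2020 (kernel `Φ`); Bombieri 2000 §4.
-/

set_option linter.dupNamespace false

noncomputable section

open Set MeasureTheory Filter Complex
open scoped Real Topology

namespace Summit.RiemannHypothesis.RiemannHypothesis.Theorems.PolarPerronFrobenius

open Literature.NumberTheory.LFunctions
open Summit.RiemannHypothesis.RiemannHypothesis.Theorems.GroundBartaFloor

/-- The smooth plateau cut-off `χ_a(t) = σ((a - t)e^{2a}) σ((a + t)e^{2a})`. -/
local notation "χ[" a "]" => (fun t : ℝ =>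
  Real.smoothTransition ((a - t) * Real.exp (2 * a)) * Real.smoothTransition ((a + t) * Real.exp (2 * a)))

/-- The real collar tail `κ_a = Φ (1 - χ_a)`. -/
local notation "κr[" a "]" => (fun t : ℝ =>
  weilThetaPhi t * (1 - Real.smoothTransition ((a - t) * Real.exp (2 * a)) *
    Real.smoothTransition ((a + t) * Real.exp (2 * a))))

/-! ## The collar geometry: `b = a − e^{−2a}` -/

/-- For `a ≥ 2`: `1 ≤ b ≤ a`, `0 ≤ b` and `e^{2b} ≥ e^{2a} − 2`, with `b = a − e^{−2a}`. [folklore] -/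
theorem collar_geometry {a : ℝ} (ha : 2 ≤ a) :
    1 ≤ a - rexp (-(2 * a)) ∧ a - rexp (-(2 * a)) ≤ a ∧
      rexp (2 * a) - 2 ≤ rexp (2 * (a - rexp (-(2 * a)))) := by
  have h1 : rexp (-(2 * a)) ≤ 1 := Real.exp_le_one_iff.2 (by linarith)
  have h2 : 0 < rexp (-(2 * a)) := Real.exp_pos _
  refine ⟨by linarith, by linarith, ?_⟩
  -- `e^{2b} = x e^{−2e^{−2a}} ≥ x (1 − 2e^{−2a}) = x − 2`
  have h3 : rexp (2 * (a - rexp (-(2 * a)))) = rexp (2 * a) * rexp (-(2 * rexp (-(2 * a)))) := by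
    rw [← Real.exp_add]; congr 1; ring
  have h4 : 1 - 2 * rexp (-(2 * a)) ≤ rexp (-(2 * rexp (-(2 * a)))) := by
    have := Real.add_one_le_exp (-(2 * rexp (-(2 * a))))
    linarith
  have h5 : rexp (2 * a) * rexp (-(2 * a)) = 1 := by rw [← Real.exp_add]; simp
  rw [h3]
  nlinarith [Real.exp_pos (2 * a), h4, h5]

/-- `e^{−πe^{2b}} ≤ e^{2π} e^{−πx}` for `b = a − e^{−2a}`, `x = e^{2a}`, `a ≥ 2`. [folklore] -/
theorem collar_exp_le {a : ℝ} (ha : 2 ≤ a) :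
    rexp (-(π * rexp (2 * (a - rexp (-(2 * a)))))) ≤ rexp (2 * π) * rexp (-(π * rexp (2 * a))) := by
  obtain ⟨-, -, h⟩ := collar_geometry ha
  rw [← Real.exp_add]
  exact Real.exp_le_exp.2 (by nlinarith [Real.pi_pos])

/-- Monotonicity of the envelopes: for `0 ≤ b ≤ s` and `c ≤ 2πe^{2b}`,
`c s − π e^{2s} ≤ c b − π e^{2b}`. [folklore] -/
theorem collar_envelope_anti {c b s : ℝ} (hbs : b ≤ s) (hc : c ≤ 2 * π * rexp (2 * b)) :
    c * s - π * rexp (2 * s) ≤ c * b - π * rexp (2 * b) := by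
  have h1 : 1 + 2 * (s - b) ≤ rexp (2 * (s - b)) := by
    have := Real.add_one_le_exp (2 * (s - b)); linarith
  have h2 : rexp (2 * s) = rexp (2 * b) * rexp (2 * (s - b)) := by
    rw [← Real.exp_add]; congr 1; ring
  have h3 : rexp (2 * b) * (1 + 2 * (s - b)) ≤ rexp (2 * s) := by
    rw [h2]; exact mul_le_mul_of_nonneg_left h1 (Real.exp_pos _).le
  nlinarith [Real.exp_pos (2 * b), Real.pi_pos, mul_nonneg Real.pi_pos.le (Real.exp_pos (2 * b)).le]

/-! ## Envelopes of `Φ` and `Φ′` beyond the bulk radius -/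

/-- `Φ(s) ≤ 2 phiUpper e^{9b/2 − πe^{2b}}` for `|s| ≥ b ≥ 1`. [folklore] -/
theorem collar_phi_le {b s : ℝ} (hb : 1 ≤ b) (hs : b ≤ |s|) :
    weilThetaPhi s ≤ 2 * phiUpper * rexp (9 / 2 * b - π * rexp (2 * b)) := by
  have h1 : weilThetaPhi s = weilThetaPhi |s| := by
    rcases le_or_gt 0 s with h | h
    · rw [abs_of_nonneg h]
    · rw [abs_of_neg h, weilThetaPhi_neg]
  rw [h1]
  refine (rateDecay_phi_upper (abs_nonneg s)).trans ?_
  refine mul_le_mul_of_nonneg_left (Real.exp_le_exp.2 ?_) (by positivity [phiUpper_pos])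
  refine collar_envelope_anti hs ?_
  have : (1 : ℝ) ≤ rexp (2 * b) := Real.one_le_exp (by linarith)
  nlinarith [Real.pi_gt_three]

/-- There is `C₁ ≥ 0` with `|Φ′(s)| ≤ C₁ e^{13b/2 − πe^{2b}}` whenever `|s| ≥ b ≥ 1`. [folklore] -/
theorem exists_collar_phiDeriv_le :
    ∃ C₁ : ℝ, 0 ≤ C₁ ∧ ∀ b s : ℝ, 1 ≤ b → b ≤ |s| →
      |weilThetaPhiDeriv s| ≤ C₁ * rexp (13 / 2 * b - π * rexp (2 * b)) := by
  obtain ⟨C₁, hC₁, h⟩ := exists_abs_weilThetaPhiDeriv_le_sharp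
  refine ⟨C₁, hC₁, fun b s hb hs => (h s).trans ?_⟩
  rw [mul_assoc, ← Real.exp_add]
  refine mul_le_mul_of_nonneg_left (Real.exp_le_exp.2 ?_) hC₁
  have h1 := collar_envelope_anti (c := 13 / 2) hs ?_
  · linarith
  · have : 1 + 2 * b ≤ rexp (2 * b) := by linarith [Real.add_one_le_exp (2 * b)]
    nlinarith [Real.pi_gt_three]

/-! ## The plateau cut-off: values and derivative -/

/-- The derivative of `Real.smoothTransition` is bounded. [folklore] -/
theorem exists_deriv_smoothTransition_le :
    ∃ M : ℝ, 0 ≤ M ∧ ∀ y : ℝ, |deriv Real.smoothTransition y| ≤ M := by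
  have hc : Continuous (deriv Real.smoothTransition) :=
    (Real.smoothTransition.contDiff (n := 1)).continuous_deriv le_rfl
  obtain ⟨M, hM⟩ := isCompact_Icc.exists_bound_of_continuousOn (hc.continuousOn (s := Icc (0 : ℝ) 1))
  refine ⟨max M 0, le_max_right _ _, fun y => ?_⟩
  by_cases hy : y ∈ Icc (0 : ℝ) 1
  · exact ((Real.norm_eq_abs _).symm.le.trans (hM y hy)).trans (le_max_left _ _)
  · -- off `[0,1]` the cut-off is locally constant
    rw [Literature.Analysis.FluidPDE.deriv_smoothTransition_eq_zero hy, abs_zero]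
    exact le_max_right _ _

/-- The derivative of the real collar tail. [folklore] -/
theorem hasDerivAt_collarTail (a s : ℝ) :
    HasDerivAt κr[a]
      (weilThetaPhiDeriv s * (1 - Real.smoothTransition ((a - s) * rexp (2 * a)) *
          Real.smoothTransition ((a + s) * rexp (2 * a))) -
        weilThetaPhi s *
          (deriv Real.smoothTransition ((a - s) * rexp (2 * a)) * (-rexp (2 * a)) *
              Real.smoothTransition ((a + s) * rexp (2 * a)) +
            Real.smoothTransition ((a - s) * rexp (2 * a)) *
              (deriv Real.smoothTransition ((a + s) * rexp (2 * a)) * rexp (2 * a)))) s := by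
  have hσ : ∀ y, HasDerivAt Real.smoothTransition (deriv Real.smoothTransition y) y := fun y =>
    ((Real.smoothTransition.contDiff (n := 1)).differentiable (by norm_num) y).hasDerivAt
  have h1 : HasDerivAt (fun s : ℝ => (a - s) * rexp (2 * a)) (-rexp (2 * a)) s := by
    have := ((hasDerivAt_const s a).sub (hasDerivAt_id s)).mul_const (rexp (2 * a))
    simpa using this
  have h2 : HasDerivAt (fun s : ℝ => (a + s) * rexp (2 * a)) (rexp (2 * a)) s := by
    have := ((hasDerivAt_const s a).add (hasDerivAt_id s)).mul_const (rexp (2 * a))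
    simpa using this
  have hA : HasDerivAt (fun s : ℝ => Real.smoothTransition ((a - s) * rexp (2 * a)))
      (deriv Real.smoothTransition ((a - s) * rexp (2 * a)) * (-rexp (2 * a))) s :=
    (hσ _).comp s h1
  have hB : HasDerivAt (fun s : ℝ => Real.smoothTransition ((a + s) * rexp (2 * a)))
      (deriv Real.smoothTransition ((a + s) * rexp (2 * a)) * rexp (2 * a)) s :=
    (hσ _).comp s h2
  have hχ := hA.mul hB
  have hΦ := hasDerivAt_weilThetaPhi s
  have h := hΦ.mul ((hasDerivAt_const s (1 : ℝ)).sub hχ)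
  refine h.congr_deriv ?_
  simp only [Pi.mul_apply, Pi.sub_apply]
  ring

/-! ## The collar bounds -/

/-- **Values of the collar tail**: `0 ≤ κ_a(s) ≤ Φ(s)`, `κ_a(s) = 0` for `|s| ≤ b`, and for `a ≥ 2`
`κ_a(s) ≤ 2 phiUpper e^{2π} x^{9/4} e^{−πx}` (`x = e^{2a}`). [folklore] -/
theorem collarTail_values {a : ℝ} (ha : 2 ≤ a) (s : ℝ) :
    0 ≤ κr[a] s ∧ κr[a] s ≤ weilThetaPhi s ∧
      (|s| ≤ a - rexp (-(2 * a)) → κr[a] s = 0) ∧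
      κr[a] s ≤ 2 * phiUpper * rexp (2 * π) * rexp (2 * a) ^ (9 / 4 : ℝ) * rexp (-(π * rexp (2 * a))) := by
  obtain ⟨hb1, hba, -⟩ := collar_geometry ha
  obtain ⟨h0, h1⟩ := thetaWin_cutoff_nonneg_le_one a s
  have hΦ := weilThetaPhi_pos s
  have hv0 : 0 ≤ κr[a] s := by
    show 0 ≤ weilThetaPhi s * (1 - _ * _)
    exact mul_nonneg hΦ.le (by simpa [mul_assoc] using sub_nonneg.2 h1)
  have hvle : κr[a] s ≤ weilThetaPhi s := by
    show weilThetaPhi s * (1 - _ * _) ≤ weilThetaPhi s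
    have : (1 : ℝ) - Real.smoothTransition ((a - s) * rexp (2 * a)) *
        Real.smoothTransition ((a + s) * rexp (2 * a)) ≤ 1 := by
      have := h0; simp only at this; linarith
    exact mul_le_of_le_one_right hΦ.le this
  have hzero : |s| ≤ a - rexp (-(2 * a)) → κr[a] s = 0 := fun hs => by
    have h := thetaWin_cutoff_eq_one (a := a) (t := s) hs
    simp only at h
    show weilThetaPhi s * (1 - _ * _) = 0
    rw [h, sub_self, mul_zero]
  refine ⟨hv0, hvle, hzero, ?_⟩
  by_cases hs : |s| ≤ a - rexp (-(2 * a))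
  · rw [hzero hs]; positivity [phiUpper_pos]
  · push Not at hs
    have hΦb := collar_phi_le hb1 hs.le
    refine hvle.trans (hΦb.trans ?_)
    have hexp := collar_exp_le ha
    have h9 : rexp (9 / 2 * (a - rexp (-(2 * a)))) ≤ rexp (2 * a) ^ (9 / 4 : ℝ) := by
      rw [← Real.exp_mul]
      exact Real.exp_le_exp.2 (by nlinarith [Real.exp_pos (-(2 * a))])
    rw [Real.exp_sub]
    rw [div_eq_mul_inv, ← Real.exp_neg]
    have hpos : 0 < 2 * phiUpper := by positivity [phiUpper_pos]
    calc 2 * phiUpper * (rexp (9 / 2 * (a - rexp (-(2 * a)))) * rexp (-(π * rexp (2 * (a - rexp (-(2 * a)))))))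
        ≤ 2 * phiUpper * (rexp (2 * a) ^ (9 / 4 : ℝ) * (rexp (2 * π) * rexp (-(π * rexp (2 * a))))) := by
          gcongr
      _ = _ := by ring

/-- **Derivative of the collar tail**: there is `K₁ ≥ 0` with `|κ_a′(s)| ≤ K₁ x^{13/4} e^{−πx}` for all
`a ≥ 2` and all `s` (`x = e^{2a}`). [folklore] -/
theorem exists_collarTail_deriv_le :
    ∃ K₁ : ℝ, 0 ≤ K₁ ∧ ∀ a : ℝ, 2 ≤ a → ∀ s : ℝ,
      |deriv κr[a] s| ≤ K₁ * rexp (2 * a) ^ (13 / 4 : ℝ) * rexp (-(π * rexp (2 * a))) := by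
  obtain ⟨C₁, hC₁, hΦ'⟩ := exists_collar_phiDeriv_le
  obtain ⟨M, hM0, hM⟩ := exists_deriv_smoothTransition_le
  have hφ := phiUpper_pos
  refine ⟨(C₁ + 4 * phiUpper * M) * rexp (2 * π), by positivity, fun a ha s => ?_⟩
  obtain ⟨hb1, hba, -⟩ := collar_geometry ha
  set b := a - rexp (-(2 * a)) with hb
  set x := rexp (2 * a) with hx
  have hxpos : 0 < x := Real.exp_pos _
  have hx1 : 1 ≤ x := Real.one_le_exp (by linarith)
  have hexp := collar_exp_le ha
  have hinv : rexp (-(2 * a)) * x = 1 := by rw [hx, ← Real.exp_add]; simp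
  rw [(hasDerivAt_collarTail a s).deriv]
  -- the two envelopes at `b` and their conversion to powers of `x`
  set R : ℝ := rexp (2 * π) * rexp (-(π * x)) with hR
  have hR0 : 0 < R := by positivity
  set E13 : ℝ := rexp (13 / 2 * b - π * rexp (2 * b)) with hE13
  set E9 : ℝ := rexp (9 / 2 * b - π * rexp (2 * b)) with hE9
  have hE13_0 : 0 < E13 := Real.exp_pos _
  have hE9_0 : 0 < E9 := Real.exp_pos _
  have hE13x : E13 ≤ x ^ (13 / 4 : ℝ) * R := by
    rw [hE13, Real.exp_sub, div_eq_mul_inv, ← Real.exp_neg]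
    have h13 : rexp (13 / 2 * b) ≤ x ^ (13 / 4 : ℝ) := by
      rw [hx, ← Real.exp_mul]
      exact Real.exp_le_exp.2 (by nlinarith [Real.exp_pos (-(2 * a))])
    exact mul_le_mul h13 hexp (Real.exp_pos _).le (by positivity)
  have hE9x : x * E9 ≤ x ^ (13 / 4 : ℝ) * R := by
    rw [hE9, Real.exp_sub, div_eq_mul_inv, ← Real.exp_neg]
    have h9 : x * rexp (9 / 2 * b) ≤ x ^ (13 / 4 : ℝ) := by
      have e1 : x * rexp (9 / 2 * b) = rexp (2 * a + 9 / 2 * b) := by rw [hx, ← Real.exp_add]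
      rw [e1, hx, ← Real.exp_mul]
      exact Real.exp_le_exp.2 (by nlinarith [Real.exp_pos (-(2 * a))])
    calc x * (rexp (9 / 2 * b) * rexp (-(π * rexp (2 * b))))
        = (x * rexp (9 / 2 * b)) * rexp (-(π * rexp (2 * b))) := by ring
      _ ≤ x ^ (13 / 4 : ℝ) * R := mul_le_mul h9 hexp (Real.exp_pos _).le (by positivity)
  -- first piece: `|Φ'(s)| (1 − χ(s)) ≤ C₁ E13`
  obtain ⟨hχ0, hχ1⟩ := thetaWin_cutoff_nonneg_le_one a s
  simp only at hχ0 hχ1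
  have h1χ : 0 ≤ 1 - Real.smoothTransition ((a - s) * rexp (2 * a)) *
      Real.smoothTransition ((a + s) * rexp (2 * a)) := by linarith
  have hA : |weilThetaPhiDeriv s * (1 - Real.smoothTransition ((a - s) * rexp (2 * a)) *
      Real.smoothTransition ((a + s) * rexp (2 * a)))| ≤ C₁ * E13 := by
    by_cases hs : |s| ≤ b
    · have h := thetaWin_cutoff_eq_one (a := a) (t := s) hs
      simp only at h
      rw [h, sub_self, mul_zero, abs_zero]
      positivity
    · push Not at hs
      rw [abs_mul, abs_of_nonneg h1χ]
      calc |weilThetaPhiDeriv s| * (1 - Real.smoothTransition ((a - s) * rexp (2 * a)) *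
            Real.smoothTransition ((a + s) * rexp (2 * a))) ≤ C₁ * E13 * 1 :=
            mul_le_mul (hΦ' b s hb1 hs.le) (by linarith) h1χ (by positivity)
        _ = C₁ * E13 := mul_one _
  -- second piece: `Φ(s) |χ'(s)| ≤ 4 phiUpper M x E9`
  have key : ∀ y : ℝ, (deriv Real.smoothTransition y ≠ 0 → b ≤ |s|) →
      weilThetaPhi s * |deriv Real.smoothTransition y| ≤ 2 * phiUpper * E9 * M := by
    intro y hy
    by_cases hd : deriv Real.smoothTransition y = 0
    · rw [hd, abs_zero, mul_zero]; positivity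
    · exact mul_le_mul (collar_phi_le hb1 (hy hd)) (hM y) (abs_nonneg _) (by positivity)
  have hy1 : deriv Real.smoothTransition ((a - s) * x) ≠ 0 → b ≤ |s| := fun hd => by
    by_contra hlt
    push Not at hlt
    apply hd
    apply Literature.Analysis.FluidPDE.deriv_smoothTransition_eq_zero
    intro hmem
    have h1 : (a - s) * x ≤ rexp (-(2 * a)) * x := by rw [hinv]; exact hmem.2
    have h2 : a - s ≤ rexp (-(2 * a)) := le_of_mul_le_mul_right h1 hxpos
    have h3 : b ≤ s := by rw [hb]; linarith
    exact (lt_irrefl _) ((h3.trans (le_abs_self s)).trans_lt hlt)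
  have hy2 : deriv Real.smoothTransition ((a + s) * x) ≠ 0 → b ≤ |s| := fun hd => by
    by_contra hlt
    push Not at hlt
    apply hd
    apply Literature.Analysis.FluidPDE.deriv_smoothTransition_eq_zero
    intro hmem
    have h1 : (a + s) * x ≤ rexp (-(2 * a)) * x := by rw [hinv]; exact hmem.2
    have h2 : a + s ≤ rexp (-(2 * a)) := le_of_mul_le_mul_right h1 hxpos
    have h3 : b ≤ -s := by rw [hb]; linarith
    exact (lt_irrefl _) ((h3.trans (neg_le_abs s)).trans_lt hlt)
  have hΦs : 0 < weilThetaPhi s := weilThetaPhi_pos s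
  have hσ1 := Real.smoothTransition.nonneg ((a + s) * x)
  have hσ1' := Real.smoothTransition.le_one ((a + s) * x)
  have hσ2 := Real.smoothTransition.nonneg ((a - s) * x)
  have hσ2' := Real.smoothTransition.le_one ((a - s) * x)
  have hB : |weilThetaPhi s *
      (deriv Real.smoothTransition ((a - s) * x) * (-x) * Real.smoothTransition ((a + s) * x) +
        Real.smoothTransition ((a - s) * x) * (deriv Real.smoothTransition ((a + s) * x) * x))| ≤
      4 * phiUpper * M * (x * E9) := by
    rw [abs_mul, abs_of_pos hΦs]
    have hd1 := abs_nonneg (deriv Real.smoothTransition ((a - s) * x))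
    have hd2 := abs_nonneg (deriv Real.smoothTransition ((a + s) * x))
    have hsum : |deriv Real.smoothTransition ((a - s) * x) * (-x) * Real.smoothTransition ((a + s) * x) +
        Real.smoothTransition ((a - s) * x) * (deriv Real.smoothTransition ((a + s) * x) * x)| ≤
        (|deriv Real.smoothTransition ((a - s) * x)| + |deriv Real.smoothTransition ((a + s) * x)|) * x := by
      refine (abs_add_le _ _).trans ?_
      rw [abs_mul, abs_mul, abs_neg, abs_of_pos hxpos, abs_of_nonneg hσ1, abs_mul, abs_mul,
        abs_of_nonneg hσ2, abs_of_pos hxpos]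
      nlinarith [mul_nonneg (mul_nonneg hd1 hxpos.le) (sub_nonneg.2 hσ1'),
        mul_nonneg (mul_nonneg hd2 hxpos.le) (sub_nonneg.2 hσ2')]
    calc weilThetaPhi s * |deriv Real.smoothTransition ((a - s) * x) * (-x) *
            Real.smoothTransition ((a + s) * x) +
          Real.smoothTransition ((a - s) * x) * (deriv Real.smoothTransition ((a + s) * x) * x)|
        ≤ weilThetaPhi s * ((|deriv Real.smoothTransition ((a - s) * x)| +
            |deriv Real.smoothTransition ((a + s) * x)|) * x) :=
          mul_le_mul_of_nonneg_left hsum hΦs.le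
      _ = (weilThetaPhi s * |deriv Real.smoothTransition ((a - s) * x)| +
            weilThetaPhi s * |deriv Real.smoothTransition ((a + s) * x)|) * x := by ring
      _ ≤ (2 * phiUpper * E9 * M + 2 * phiUpper * E9 * M) * x :=
          mul_le_mul_of_nonneg_right (add_le_add (key _ hy1) (key _ hy2)) hxpos.le
      _ = 4 * phiUpper * M * (x * E9) := by ring
  -- combine
  have hA' : C₁ * E13 ≤ C₁ * (x ^ (13 / 4 : ℝ) * R) := mul_le_mul_of_nonneg_left hE13x hC₁
  have hB' : 4 * phiUpper * M * (x * E9) ≤ 4 * phiUpper * M * (x ^ (13 / 4 : ℝ) * R) :=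
    mul_le_mul_of_nonneg_left hE9x (by positivity)
  calc |weilThetaPhiDeriv s * (1 - Real.smoothTransition ((a - s) * x) *
          Real.smoothTransition ((a + s) * x)) -
        weilThetaPhi s *
          (deriv Real.smoothTransition ((a - s) * x) * (-x) * Real.smoothTransition ((a + s) * x) +
            Real.smoothTransition ((a - s) * x) * (deriv Real.smoothTransition ((a + s) * x) * x))|
      ≤ C₁ * E13 + 4 * phiUpper * M * (x * E9) := (abs_sub _ _).trans (add_le_add hA hB)
    _ ≤ C₁ * (x ^ (13 / 4 : ℝ) * R) + 4 * phiUpper * M * (x ^ (13 / 4 : ℝ) * R) := add_le_add hA' hB'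
    _ = (C₁ + 4 * phiUpper * M) * rexp (2 * π) * x ^ (13 / 4 : ℝ) * rexp (-(π * x)) := by
        rw [hR]; ring

end Summit.RiemannHypothesis.RiemannHypothesis.Theorems.PolarPerronFrobenius

end
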